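import Summits.QuantumFields.BalabanUV.T4Continuum.Spine.NE1p.DressedRootFam

/-!
# T⁴ programme, spine estimate NE1′ (node O3b/H2) — ROOT-C OF RECORD REPAIRED: the class form WITH THE STRICT PRODUCT against the
# positional rate (owner's disposition of GAPS G-wardbootg6-1), its END, its implication to ROOT-B, and the kernel witness that the
# product-free headline `DressedStability` is NOT sufficient

Cell `pub-balaban`, sub-cell `t4`, BINDER-OWNERS row NE1′; owner lineage t4-ne1p-p1 (PROVER seat P1 «RG-trajectory comparison»),
generation 23; tree target `Summits/QuantumFields/BalabanUV/T4Continuum/Spine/NE1p/`; ADDITIVE — imports `Spine/NE1p/DressedRootFam`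
ONLY, modifies nothing (every declaration of `DressedRoot` ∕ `DressedRootFam` ∕ `DressedRootWitness` unchanged).

THE OBJECTION (ward-bootstrap card seat g6, GAPS `G-wardbootg6-1`, LOCATED — our own typing, no theorem wrong): the headline
`DressedRoot.DressedStability 𝒯 := ∃ A₀ ρ₁ τ, DressedStabilityWith 𝒯 A₀ ρ₁ τ` closes over the rates WITHOUT the product against the
bookings' positional rate `Λ`, so `τ` is idle and `ρ₁` may exceed `1`: the ∃-statement is met by observable-attached terms that DOUBLE
at every RG step, and ROOT-C-as-∃ does NOT imply ROOT-B (`DressedRootFam.DressedBudget`).  The theorems were right as typed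
(`cubeBudget_of_dressedStabilityWith (hprod : Λρ₁τ ≤ 1)`, `dressedBudget_of_dressedStabilityWith_strict (hr : Λρ₁τ ≤ r) (hr1 : r < 1)`);
only the NAMED ∃ threw the product away.  OWNER'S DISPOSITION = the row's repair (a): ROOT-C OF RECORD is the class WITH the strict
product, typed here; `DressedStability` stays a headline ABBREVIATION (necessary, not sufficient); ROOT-B `DressedBudget` stays the
door-neutral root every END-ALL face also concludes.

* §1 `DressedStabilityStrict 𝒯 Λ` [shape] := `∃ A₀ ρ₁ τ r, DressedStabilityWith 𝒯 A₀ ρ₁ τ ∧ 0 ≤ Λ ∧ Λ·ρ₁·τ ≤ r ∧ r < 1` — ROOT-C OF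
  RECORD; `dressedStability_of_strict` (the headline is a corollary); **`dressedStabilityStrict_of_bookingLeaves`** — END-B proves it
  VERBATIM from ONE `U : UniformConstants` (`U.hprod`, `U.hρ'1`, `U.hΛ` are fields) at `Λ = U.Λ`; **`dressedBudget_of_dressedStabilityStrict`**
  — ROOT-C of record ⟹ ROOT-B given K-free positional counts at rate `Λ` and run weights `≤ w̄` (IS `dressedBudget_of_dressedStabilityWith_strict`).
* §2 THE DOUBLING TOWER [decided toy]: `growingBooking K` ∕ `growingTrajectory K` ∕ `growingTower` — one family per cutoff, born at
  scale `0`, booked size `2^k` at scale `k`, felt at one cube of every scale; `dressedStability_growingTower : DressedStability growingTower`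
  (`A₀ = 1, ρ₁ = 2, τ = 1`) YET `not_dressedBudget_growingTower : ¬ DressedBudget growingTower (fun _ _ _ => 1)` (the top cube's load is
  `2^K → ∞`) — hence `dressedStability_not_imp_dressedBudget`: the product-free headline is NOT a sufficient root even with unit
  weights, and `not_dressedStabilityStrict_growingTower` (Λ = 1): the strict root REJECTS the doubling tower.  With
  `DressedRootSeparation` (crew W4: quantifier ORDER is content) this completes the kernel record of what the root's wording must carry:
  uniform constants AND the strict product.

HONEST FRAMING.  Our own typing repaired; a decided toy; [folklore]-free bookkeeping, 0 sorry, 0 citations.  NE1′ ⇐ the named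
binders, NOT proved; the wall (w1), (w2-act) [THE NUMBER], (w3)⁺, (w4)–(w7) stands DISPLAYED; 0 leaves instantiated on Bałaban's
densities; spine PROVED 0∕9.  Rung (B)+1 on ONE finite four-torus — NOT infinite volume, NOT a mass gap, NOT OS on ℝ⁴, NOT Clay.
HONEST DEPENDENCY: continuum YM on T⁴ ⇐ BetaPertH ∧ nine spine estimates (0/9 proved); BetaPertH ⇐ (D1) ∧ (D4) ∧ CAP+tail;
G-an2-4 gates asym, D1 and NE2/3/4.
-/

noncomputable section

namespace Summit.QuantumFields.BalabanUV.T4Continuum.NE1p.DressedRoot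

open Finset
open scoped BigOperators
open Literature.MathematicalPhysics.QuantumFieldTheory.Balaban1983to89
open Literature.MathematicalPhysics.QuantumFieldTheory.Balaban1983to89.T4TermFormat
open Literature.MathematicalPhysics.QuantumFieldTheory.Balaban1983to89.T4TermFormat.Booking
open Literature.MathematicalPhysics.QuantumFieldTheory.Balaban1983to89.T4GatedBooking
open Literature.MathematicalPhysics.QuantumFieldTheory.Balaban1983to89.T4TrajectoryComparison
open Summit.QuantumFields.BalabanUV.T4Continuum.T4TrajectoryDensityDressed

/-! ## §1 ROOT-C of record: the class with the strict product -/

/-- **ROOT-C OF RECORD — DRESSED STABILITY WITH THE STRICT PRODUCT** [shape]: K- and μ-free `A₀, ρ₁, τ` (class) and `r < 1` with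
`Λ·ρ₁·τ ≤ r` against the bookings' positional rate `Λ ≥ 0`, such that at every cutoff and run parameter the booked
observable-attached terms lie in `twoRate A₀ ρ₁ τ K`.  NOT PRINTED; NOT PROVED; never asserted. [folklore] -/
def DressedStabilityStrict {P : Type*} (𝒯 : DressedTower P) (Λ : ℝ) : Prop :=
  ∃ A₀ ρ₁ τ r : ℝ, DressedStabilityWith 𝒯 A₀ ρ₁ τ ∧ 0 ≤ Λ ∧ Λ * ρ₁ * τ ≤ r ∧ r < 1

/-- The product-free headline is a COROLLARY of the root of record (necessary, not sufficient — §2). [folklore] -/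
theorem dressedStability_of_strict {P : Type*} {𝒯 : DressedTower P} {Λ : ℝ} (h : DressedStabilityStrict 𝒯 Λ) :
    DressedStability 𝒯 := by
  obtain ⟨A₀, ρ₁, τ, _, hW, -, -, -⟩ := h
  exact ⟨A₀, ρ₁, τ, hW⟩

/-- **END-B PROVES THE ROOT OF RECORD VERBATIM** [bookkeeping]: ONE `U : UniformConstants` serving the leaf bundle at every `(p, K)`
gives `DressedStabilityStrict 𝒯 U.Λ` — the strict product and its `r = ρ′ < 1` are FIELDS of `U` ((w7)). [folklore] -/
theorem dressedStabilityStrict_of_bookingLeaves {P : Type*} (U : UniformConstants) (𝒯 : DressedTower P)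
    (L : ∀ p K, BookingLeaves U (𝒯.B p K) (𝒯.T p K)) : DressedStabilityStrict 𝒯 U.Λ :=
  ⟨U.A₀, U.ρ₁, U.τ, U.ρ', dressedStabilityWith_of_bookingLeaves U 𝒯 L, U.hΛ, U.hprod, U.hρ'1⟩

/-- Any displayed-constants face with the product data in hand feeds the root of record (for the crew's END-ALL faces, whose
constants are explicit). [folklore] -/
theorem dressedStabilityStrict_of_with {P : Type*} {𝒯 : DressedTower P} {A₀ ρ₁ τ Λ r : ℝ}
    (hW : DressedStabilityWith 𝒯 A₀ ρ₁ τ) (hΛ : 0 ≤ Λ) (hr : Λ * ρ₁ * τ ≤ r) (hr1 : r < 1) :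
    DressedStabilityStrict 𝒯 Λ :=
  ⟨A₀, ρ₁, τ, r, hW, hΛ, hr, hr1⟩

/-- **ROOT-C OF RECORD ⟹ ROOT-B** [bookkeeping]: with K-free positional counts at the SAME rate `Λ` and run weight profiles bounded by
one `w̄ ≥ 0`, the strict class root gives the budget root (`dressedBudget_of_dressedStabilityWith_strict` by name). [folklore] -/
theorem dressedBudget_of_dressedStabilityStrict {P : Type*} {𝒯 : DressedTower P} {Λ N₀ wbar : ℝ} {w : P → ℕ → ℕ → ℝ}
    (h : DressedStabilityStrict 𝒯 Λ) (hN₀ : 0 ≤ N₀) (hwbar : 0 ≤ wbar)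
    (hw0 : ∀ p K, ∀ j ≤ K, 0 ≤ w p K j) (hwb : ∀ p K, ∀ j ≤ K, w p K j ≤ wbar)
    (hcount : ∀ p K, (𝒯.B p K).PositionalCount fun j k => N₀ * Λ ^ (k - j)) :
    DressedBudget 𝒯 w := by
  obtain ⟨A₀, ρ₁, τ, r, hW, hΛ, hr, hr1⟩ := h
  exact dressedBudget_of_dressedStabilityWith_strict hW hN₀ hΛ hr hr1 hwbar hw0 hwb hcount

/-! ## §2 The doubling tower: the product-free headline holds, the budget and the strict root fail -/

section Growing

/-- TOY BOOKING at cutoff `K` [decided toy]: one observable-attached family, born at scale `0`, felt at one cube of every scale, with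
booked size `2^k` at scale `k` — the terms DOUBLE at every step. [folklore] -/
def growingBooking (K : ℕ) : T4TermFormat.Booking where
  K := K
  Dom := Unit
  domScale := fun _ => 0
  treeLen := fun _ => 0
  treeLen_nonneg := fun _ => le_rfl
  balSize := fun _ => 0
  Birth := Unit
  births := {()}
  mem_births := fun b => by simp
  birthScale := fun _ => 0
  birth_le := fun _ => Nat.zero_le K
  loc := fun _ => ()
  loc_scale := fun _ => rfl
  Cube := Fin (K + 1)
  cubes := Finset.univ
  mem_cubes := fun q => Finset.mem_univ q
  cubeScale := fun q => q.val
  cube_le := fun q => Nat.lt_succ_iff.mp q.isLt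
  feltAt := fun _ => {()}
  felt_birth_le := fun _ _ _ => Nat.zero_le _
  size := fun _ k => (2 : ℝ) ^ k
  size_nonneg := fun _ _ => by positivity
  pair := fun _ _ _ => 0

/-- Its trajectory [decided toy]: one generation (the birth, size `1`), re-linearised size `2^k`. [folklore] -/
def growingTrajectory (K : ℕ) : Trajectory (growingBooking K) where
  lin := fun _ k' k => if k' = 0 then (2 : ℝ) ^ k else 0
  lin_nonneg := fun _ k' k => by split_ifs <;> positivity
  gen := fun _ k' => if k' = 0 then (1 : ℝ) else 0
  gen_nonneg := fun _ k' => by split_ifs <;> norm_num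
  size_le := fun b k _ _ => by
    show (2 : ℝ) ^ k ≤ ∑ k' ∈ Icc 0 k, (if k' = 0 then (2 : ℝ) ^ k else 0)
    rw [Finset.sum_ite_eq' (Icc 0 k) 0 (fun _ => (2 : ℝ) ^ k)]
    simp

/-- THE DOUBLING TOWER [decided toy]. [folklore] -/
def growingTower : DressedTower Unit where
  B := fun _ K => growingBooking K
  K_eq := fun _ _ => rfl
  T := fun _ K => growingTrajectory K

/-- The product-free headline HOLDS on the doubling tower (`A₀ = 1`, `ρ₁ = 2`, `τ = 1`). [folklore] -/
theorem dressedStability_growingTower : DressedStability growingTower := by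
  refine ⟨1, 2, 1, zero_le_one, by norm_num, zero_le_one, le_rfl, fun _ K b k _ _ => ?_⟩
  show (2 : ℝ) ^ k ≤ twoRate 1 2 1 K 0 k
  simp [twoRate]

/-- The top cube of the cutoff-`K` run carries load `≥ 2^K` at unit weights. [folklore] -/
theorem top_load_growing (K : ℕ) :
    (2 : ℝ) ^ K ≤ ∑ j ∈ range (K + 1), (1 : ℝ) * (growingBooking K).load ⟨K, Nat.lt_succ_self K⟩ j := by
  have h0 : (growingBooking K).load ⟨K, Nat.lt_succ_self K⟩ 0 = (2 : ℝ) ^ K := by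
    simp [Booking.load, Booking.feltOfScale, growingBooking]
  have hnonneg : ∀ j ∈ range (K + 1), 0 ≤ (1 : ℝ) * (growingBooking K).load ⟨K, Nat.lt_succ_self K⟩ j :=
    fun j _ => by rw [one_mul]; exact Booking.load_nonneg _ _
  calc (2 : ℝ) ^ K = (1 : ℝ) * (growingBooking K).load ⟨K, Nat.lt_succ_self K⟩ 0 := by rw [one_mul, h0]
    _ ≤ ∑ j ∈ range (K + 1), (1 : ℝ) * (growingBooking K).load ⟨K, Nat.lt_succ_self K⟩ j :=
        single_le_sum hnonneg (mem_range.mpr (Nat.succ_pos K))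

/-- **THE BUDGET FAILS on the doubling tower** at unit weights: no K-free constant bounds the top cube's load `2^K`. [folklore] -/
theorem not_dressedBudget_growingTower : ¬ DressedBudget growingTower (fun _ _ _ => (1 : ℝ)) := by
  rintro ⟨cB, hcB⟩
  set K := ⌈cB⌉₊ with hK
  have h1 : (2 : ℝ) ^ K ≤ cB := (top_load_growing K).trans (hcB () K ⟨K, Nat.lt_succ_self K⟩)
  have h2 : cB < (2 : ℝ) ^ K := by
    calc cB ≤ (K : ℝ) := Nat.le_ceil cB
      _ < (2 : ℝ) ^ K := by exact_mod_cast Nat.lt_two_pow_self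
  exact absurd h1 (not_le.mpr h2)

/-- **THE PRODUCT-FREE HEADLINE IS NOT A SUFFICIENT ROOT** (G-wardbootg6-1 in kernel): `DressedStability` does not imply `DressedBudget`,
not even at unit weights. [folklore] -/
theorem dressedStability_not_imp_dressedBudget :
    ¬ (∀ (𝒯 : DressedTower Unit), DressedStability 𝒯 → DressedBudget 𝒯 (fun _ _ _ => (1 : ℝ))) :=
  fun h => not_dressedBudget_growingTower (h growingTower dressedStability_growingTower)

/-- The doubling tower has K-free positional counts at rate `Λ = 1` (one birth felt per cube). [folklore] -/
theorem positionalCount_growing (K : ℕ) : (growingBooking K).PositionalCount fun j k => (1 : ℝ) * (1 : ℝ) ^ (k - j) := by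
  intro q j
  show (((growingBooking K).feltOfScale q j).card : ℝ) ≤ 1 * 1 ^ ((growingBooking K).cubeScale q - j)
  rw [one_pow, mul_one]
  have : ((growingBooking K).feltOfScale q j).card ≤ 1 :=
    (Finset.card_filter_le _ _).trans (by simp [growingBooking])
  exact_mod_cast this

/-- **THE STRICT ROOT REJECTS THE DOUBLING TOWER** (at the tower's own positional rate `Λ = 1`): otherwise ROOT-B would follow.
[folklore] -/
theorem not_dressedStabilityStrict_growingTower : ¬ DressedStabilityStrict growingTower 1 := fun h =>
  not_dressedBudget_growingTower
    (dressedBudget_of_dressedStabilityStrict (N₀ := 1) (wbar := 1) h zero_le_one zero_le_one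
      (fun _ _ _ _ => zero_le_one) (fun _ _ _ _ => le_rfl) fun _ K => positionalCount_growing K)

end Growing

end Summit.QuantumFields.BalabanUV.T4Continuum.NE1p.DressedRoot

end
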